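import Mathlib.FieldTheory.IsAlgClosed.Basic
import Mathlib.FieldTheory.Perfect
import Mathlib.LinearAlgebra.FiniteDimensional.Defs
import Mathlib.LinearAlgebra.Matrix.ToLin
import Mathlib.Data.ZMod.Basic
import Mathlib.Algebra.CharP.Lemmas
import Literature.RepresentationTheory.Semisimple.FiniteFieldDescentFinTwo
import HarnessLib

/-!
# Route `PhantomRMYoshida`, support item `PhantomRMTransport` (stmt-Langlands-13641): the
# coordinatewise Frobenius on `kⁿ`

Helpers for the transport lemma `Summit.Langlands.Langlands.Theses.PhantomRMYoshida.PhantomRMTransport`: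
for a field `k` of characteristic `p` and the Frobenius `F = frobenius k p`, the coordinatewise map
`v ↦ F ∘ v` on `Fin n → k` is additive and `F (c • v) = c ^ p • F v`, commutes with matrices fixed
by `F` (in particular with matrices coming from `𝔽_p = ZMod p`), its fixed vectors are exactly the
vectors with coordinates in `𝔽_p` (`Literature.RepresentationTheory.Semisimple.mem_range_iff_pow_card_eq`),
it preserves linear independence when `k` is perfect, and over an algebraically closed `k` a line
stable under a power `F^[m]` contains a non-zero `F^[m]`-fixed vector (root extraction
`t ^ (q - 1) = μ⁻¹`).
-/

set_option linter.dupNamespace false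
set_option autoImplicit false

namespace Summit.Langlands.Langlands.Theorems.PhantomRMTransport

open Matrix

universe u

variable {p : ℕ} [Fact p.Prime] {k : Type u} [Field k] [CharP k p]

/-- `F (ι x) = ι x` for `ι : 𝔽_p → k`. [folklore] -/
theorem frobenius_ringHom_apply (ι : ZMod p →+* k) (x : ZMod p) : frobenius k p (ι x) = ι x := by
  rw [frobenius_def, ← map_pow, ZMod.pow_card]

/-- A matrix with entries in `𝔽_p` is fixed by the entrywise Frobenius. [folklore] -/
theorem map_frobenius_map_ringHom (ι : ZMod p →+* k) {m n : Type*} (A : Matrix m n (ZMod p)) :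
    (A.map ι).map (frobenius k p) = A.map ι := by
  ext i j
  exact frobenius_ringHom_apply ι (A i j)

/-- The image of `𝔽_p` in `k` is the fixed set of Frobenius. [folklore] -/
theorem mem_range_ringHom_iff (ι : ZMod p →+* k) (y : k) : y ∈ Set.range ι ↔ frobenius k p y = y := by
  rw [Literature.RepresentationTheory.Semisimple.mem_range_iff_pow_card_eq ι y, ZMod.card, frobenius_def]

/-- A Frobenius-fixed vector has coordinates in `𝔽_p`. [folklore] -/
theorem exists_eq_ringHom_comp (ι : ZMod p →+* k) {n : ℕ} (v : Fin n → k)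
    (hv : frobenius k p ∘ v = v) : ∃ u : Fin n → ZMod p, v = ι ∘ u := by
  have h : ∀ i, ∃ x : ZMod p, ι x = v i := fun i =>
    (mem_range_ringHom_iff ι (v i)).2 (congrFun hv i)
  choose u hu using h
  exact ⟨u, funext fun i => (hu i).symm⟩

/-- Coordinatewise Frobenius of a matrix–vector product. [folklore] -/
theorem frobenius_comp_mulVec {m n : Type*} [Fintype n] (B : Matrix m n k) (v : n → k) :
    frobenius k p ∘ (B *ᵥ v) = B.map (frobenius k p) *ᵥ (frobenius k p ∘ v) := by
  funext i
  exact RingHom.map_mulVec (frobenius k p) B v i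

/-- Coordinatewise Frobenius of a scalar multiple. [folklore] -/
theorem frobenius_comp_smul {n : Type*} (c : k) (v : n → k) :
    frobenius k p ∘ (c • v) = (c ^ p) • (frobenius k p ∘ v) := by
  funext i
  simp only [Function.comp_apply, Pi.smul_apply, smul_eq_mul, map_mul, frobenius_def]

/-- Coordinatewise Frobenius of a sum of vectors. [folklore] -/
theorem frobenius_comp_add {n : Type*} (v w : n → k) :
    frobenius k p ∘ (v + w) = frobenius k p ∘ v + frobenius k p ∘ w := by
  funext i
  simp only [Function.comp_apply, Pi.add_apply, map_add]

/-- Coordinatewise Frobenius of a linear combination. [folklore] -/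
theorem frobenius_comp_sum_smul {n : Type*} {ι : Type*} (s : Finset ι) (c : ι → k) (v : ι → n → k) :
    frobenius k p ∘ (∑ i ∈ s, c i • v i) = ∑ i ∈ s, (c i ^ p) • (frobenius k p ∘ v i) := by
  funext j
  simp only [Function.comp_apply, Finset.sum_apply, Pi.smul_apply, smul_eq_mul, map_sum, map_mul,
    frobenius_def]

/-- Coordinatewise Frobenius is injective. [folklore] -/
theorem frobenius_comp_injective {n : Type*} : Function.Injective fun v : n → k => frobenius k p ∘ v := by
  intro v w h
  funext i
  exact frobenius_inj k p (congrFun h i)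

/-- The zero vector is the only vector killed by coordinatewise Frobenius. [folklore] -/
theorem frobenius_comp_eq_zero_iff {n : Type*} (v : n → k) : frobenius k p ∘ v = 0 ↔ v = 0 := by
  constructor
  · intro h
    apply frobenius_comp_injective (p := p)
    change frobenius k p ∘ v = frobenius k p ∘ (0 : n → k)
    rw [h]
    funext i
    simp
  · rintro rfl
    funext i
    simp

/-- Over a perfect field, coordinatewise Frobenius preserves linear independence (it is semilinear
for the bijective Frobenius of `k`). [folklore] -/
theorem linearIndependent_frobenius_comp [PerfectRing k p] {m : ℕ} {n : Type*} {b : Fin m → n → k}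
    (hb : LinearIndependent k b) : LinearIndependent k fun i => frobenius k p ∘ b i := by
  rw [Fintype.linearIndependent_iff] at hb ⊢
  intro c hc i
  -- take `p`-th roots of the coefficients
  let d : Fin m → k := fun i => (frobeniusEquiv k p).symm (c i)
  have hd : ∀ i, d i ^ p = c i := fun i => by
    change frobenius k p ((frobeniusEquiv k p).symm (c i)) = c i
    exact frobeniusEquiv_symm_apply_frobenius k p (c i) ▸ (frobeniusEquiv k p).apply_symm_apply (c i)
  have hsum : frobenius k p ∘ (∑ i, d i • b i) = 0 := by
    rw [frobenius_comp_sum_smul]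
    simp_rw [hd]
    exact hc
  rw [frobenius_comp_eq_zero_iff] at hsum
  have := hb d hsum i
  rw [← hd i, this, zero_pow (Fact.out : p.Prime).ne_zero]

/-- Root extraction in an algebraically closed field: for `μ ≠ 0` and `q > 1` there is `t ≠ 0` with
`t ^ q * μ = t` (take `t ^ (q - 1) = μ⁻¹`). Used to make an `F^[m]`-stable line `F^[m]`-pointwise
generated: if `F^[m] v = μ • v` then `F^[m] (t • v) = t • v`. [folklore] -/
theorem exists_ne_zero_pow_mul_eq [IsAlgClosed k] (μ : k) (hμ : μ ≠ 0) {q : ℕ} (hq : 1 < q) :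
    ∃ t : k, t ≠ 0 ∧ t ^ q * μ = t := by
  obtain ⟨t, ht⟩ := IsAlgClosed.exists_pow_nat_eq μ⁻¹ (Nat.sub_pos_of_lt hq)
  have ht0 : t ≠ 0 := by
    rintro rfl
    rw [zero_pow (Nat.sub_pos_of_lt hq).ne'] at ht
    exact inv_ne_zero hμ ht.symm
  refine ⟨t, ht0, ?_⟩
  have hq' : q = (q - 1) + 1 := (Nat.sub_add_cancel hq.le).symm
  rw [hq', pow_succ, ht, mul_comm, ← mul_assoc, mul_inv_cancel₀ hμ, one_mul]

end Summit.Langlands.Langlands.Theorems.PhantomRMTransport
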